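import Literature.NumberTheory.Automorphic.HeckeAlgebraFixedPointsProofs
import Literature.NumberTheory.Automorphic.HeckeGelfandTrick
import HarnessLib

/-!
# The double-coset operators `T_{KgK} ∈ ℋ(G, K) = End_G(k[G ⧸ K])` and their calculus

Topic `NumberTheory/Automorphic`; namespace `Literature.NumberTheory.Automorphic.heckeAlgebra`.
A complement to the Frobenius-reciprocity material of `HeckeAlgebra` (`heckeAlgebra.extend`,
the double-coset coordinates `heckeAlgebra.doubleCosetCoeffEquiv : ℋ(G, K) ≃ₗ (K\G/K →₀ k)` and
the basis `exists_basis_heckeAlgebra_holds`) and of `HeckeAlgebraFixedPointsProofs`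
(`heckeAlgebra.liftRep`): it names the basis element of a double coset and records the rules for
computing with it that the Satake isomorphism for `GL_n` (`SatakeTransformGL`,
`SatakeParametersGLIsoProofs`) uses.  Everything is proved; no named facts.

* `heckeAlgebra.toVector K T = T [K]` (`k`-linear, injective: `toVector_injective`) and
  `heckeAlgebra.ofVector K v hv = ⟨extend K v, _⟩`; together the `k`-linear Frobenius reciprocity
  `heckeAlgebra.equivFixedPoints : ℋ(G, K) ≃ₗ[k] k[G ⧸ K]^K` (no Hecke-pair hypothesis), with
  the **product rule** `toVector_mul_eq_sum`:
  `(S T) [K] = ∑_γ (T [K])(γ) • π(γ.out) (S [K])`.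
* `heckeAlgebra.doubleCosetOperator K g` (for a Hecke pair): the element with
  `[K] ↦ 𝟙_{KgK}`; it *is* the basis vector of `exists_basis_heckeAlgebra_holds` /
  `doubleCosetCoeffEquiv` at `KgK` (`doubleCosetOperator_eq_doubleCosetCoeffEquiv_symm`,
  `ofRepr_doubleCosetCoeffEquiv_apply`), so `mem_span_doubleCosetOperator` below is the
  support-controlled refinement of the spanning half of that basis statement.
* Rules: `toVector_mul_doubleCosetOperator` (`(S · T_g) [K] = [KgK] (S [K])`: right
  multiplication by `T_g` is the concrete Hecke operator `heckeOperator` on `k[G ⧸ K]^K`, through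
  `liftRep_doubleCosetIndicator`), `doubleCosetOperator_one`, `doubleCosetOperator_mul_mul_eq`
  (dependence on `KgK` only), `exists_eq_out_smul_of_coeff_ne_zero` (the support of
  `(T_g T_h) [K]` lies in `KhK·KgK / K`), `mem_span_doubleCosetOperator` (every `T` is a
  combination of the `T_{γ.out}` over the support of `T [K]`), `doubleCosetOperator_central_mul`
  (**central twist**, Shimura, Prop. 3.17: `T_z T_g = T_{zg}` for central `z`).

## References

* G. Shimura, *Introduction to the arithmetic theory of automorphic functions* (1971), §3.1,
  Prop. 3.1; §3.2, Prop. 3.17 [ShimuraIATAF1971].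
* D. Bump, *Automorphic Forms and Representations* (1997), Prop. 4.1.2 [Bump1997].
* P. Cartier, *Representations of p-adic groups: a survey*, Corvallis 1979, §I.4, §IV.1
  [CartierCorvallis1979].
-/

noncomputable section

open scoped Pointwise
open MulAction MonoidAlgebra Representation

namespace Literature.NumberTheory.Automorphic

namespace heckeAlgebra

variable {k G : Type*} [CommRing k] [Group G] (K : Subgroup G)

/-! ### `T ↦ T [K]` and Frobenius reciprocity -/

/-- The vector `T [K] ∈ k[G ⧸ K]` of `T ∈ ℋ(G, K) = End_G(k[G ⧸ K])` (image of the basis vector of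
the trivial coset), `k`-linear in `T`. [folklore] -/
def toVector : heckeAlgebra k G K →ₗ[k] MonoidAlgebra k (G ⧸ K) where
  toFun T := (T : Module.End k (MonoidAlgebra k (G ⧸ K))) (single ((1 : G) : G ⧸ K) 1)
  map_add' _ _ := rfl
  map_smul' _ _ := rfl

/-- Unfolding lemma for `toVector`. [folklore] -/
theorem toVector_apply (T : heckeAlgebra k G K) :
    toVector K T = (T : Module.End k (MonoidAlgebra k (G ⧸ K))) (single ((1 : G) : G ⧸ K) 1) :=
  rfl

/-- `T [K]` is `K`-invariant (restatement of `ofMulAction_apply_single_one` for `toVector`).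
[folklore] -/
theorem ofMulAction_toVector (T : heckeAlgebra k G K) {a : G} (ha : a ∈ K) :
    ofMulAction k G (G ⧸ K) a (toVector K T) = toVector K T :=
  ofMulAction_apply_single_one K T a ha

/-- `T [K] ∈ k[G ⧸ K]^K`. [folklore] -/
theorem toVector_mem_fixedPoints (T : heckeAlgebra k G K) :
    toVector K T ∈ (ofMulAction k G (G ⧸ K)).fixedPoints K :=
  (Representation.mem_fixedPoints _ K _).2 fun _ ha => ofMulAction_toVector K T ha

/-- `T ↦ T [K]` is injective on `ℋ(G, K)` (the double-coset coordinates `doubleCosetCoeff` factor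
through it). [folklore] -/
theorem toVector_injective : Function.Injective (toVector (k := k) K) := by
  intro S T h
  apply doubleCosetCoeff_injective K
  refine Finsupp.ext fun D => ?_
  rw [doubleCosetCoeff_apply, doubleCosetCoeff_apply, ← toVector_apply, ← toVector_apply, h]

/-- The element of `ℋ(G, K)` with `[K] ↦ v`, for a `K`-invariant `v ∈ k[G ⧸ K]`: the
`G`-endomorphism `extend K v` of `HeckeAlgebra`, bundled. [folklore] -/
def ofVector (v : MonoidAlgebra k (G ⧸ K)) (hv : ∀ a ∈ K, ofMulAction k G (G ⧸ K) a v = v) :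
    heckeAlgebra k G K :=
  ⟨extend K v, extend_mem K hv⟩

/-- Unfolding lemma for `ofVector`. [folklore] -/
@[simp]
theorem coe_ofVector (v : MonoidAlgebra k (G ⧸ K))
    (hv : ∀ a ∈ K, ofMulAction k G (G ⧸ K) a v = v) :
    (ofVector K v hv : Module.End k (MonoidAlgebra k (G ⧸ K))) = extend K v :=
  rfl

/-- `extend K v [K] = v` for `K`-invariant `v`. [folklore] -/
theorem extend_single_one {v : MonoidAlgebra k (G ⧸ K)}
    (hv : ∀ a ∈ K, ofMulAction k G (G ⧸ K) a v = v) :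
    extend K v (single ((1 : G) : G ⧸ K) 1) = v := by
  obtain ⟨h, H⟩ := QuotientGroup.mk_out_eq_mul K (1 : G)
  rw [extend_single, one_smul, H, one_mul, hv _ h.2]

/-- `toVector ∘ ofVector = id`. [folklore] -/
@[simp]
theorem toVector_ofVector (v : MonoidAlgebra k (G ⧸ K))
    (hv : ∀ a ∈ K, ofMulAction k G (G ⧸ K) a v = v) : toVector K (ofVector K v hv) = v :=
  extend_single_one K hv

/-- `ofVector ∘ toVector = id`: every `T ∈ End_G(k[G ⧸ K])` is `extend K (T [K])`. [folklore] -/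
theorem ofVector_toVector (T : heckeAlgebra k G K) :
    ofVector K (toVector K T) (fun _ ha => ofMulAction_toVector K T ha) = T :=
  toVector_injective K (toVector_ofVector K _ _)

/-- Pointwise form: `T f = extend K (T [K]) f`. [folklore] -/
theorem apply_eq_extend_toVector (T : heckeAlgebra k G K) (f : MonoidAlgebra k (G ⧸ K)) :
    (T : Module.End k (MonoidAlgebra k (G ⧸ K))) f = extend K (toVector K T) f := by
  conv_lhs => rw [← ofVector_toVector K T]
  rfl

/-- `extend K v f = liftRep K π f v` for the permutation representation `π`: the two Frobenius
reciprocity maps of `HeckeAlgebra` and `HeckeAlgebraFixedPointsProofs` agree. [folklore] -/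
theorem extend_apply_eq_liftRep (v f : MonoidAlgebra k (G ⧸ K)) :
    extend K v f = liftRep K (ofMulAction k G (G ⧸ K)) f v := by
  simp only [extend, liftRep, LinearMap.coe_comp, LinearEquiv.coe_coe, Function.comp_apply,
    Finsupp.linearCombination_apply, Finsupp.sum, LinearMap.sum_apply, LinearMap.smul_apply]

/-- **Frobenius reciprocity** `ℋ(G, K) = End_G(k[G ⧸ K]) ≃ₗ[k] k[G ⧸ K]^K`, `T ↦ T [K]`, for any
pair `K ≤ G` (Bump (1997), Prop. 4.1.2; Cartier, Corvallis 1979, §I.4).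
[cite: Bump1997, Prop. 4.1.2] -/
def equivFixedPoints : heckeAlgebra k G K ≃ₗ[k] (ofMulAction k G (G ⧸ K)).fixedPoints K where
  toFun T := ⟨toVector K T, toVector_mem_fixedPoints K T⟩
  map_add' _ _ := rfl
  map_smul' _ _ := rfl
  invFun w := ofVector K w fun a ha => (Representation.mem_fixedPoints _ K _).1 w.2 a ha
  left_inv T := ofVector_toVector K T
  right_inv _ := Subtype.ext (toVector_ofVector K _ _)

/-- `equivFixedPoints T = T [K]`. [folklore] -/
theorem coe_equivFixedPoints (T : heckeAlgebra k G K) :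
    (equivFixedPoints K T : MonoidAlgebra k (G ⧸ K)) = toVector K T :=
  rfl

/-- `(S T) [K] = S (T [K])`. [folklore] -/
theorem toVector_mul (S T : heckeAlgebra k G K) :
    toVector K (S * T) = (S : Module.End k (MonoidAlgebra k (G ⧸ K))) (toVector K T) :=
  rfl

/-- `1 [K] = [K]`. [folklore] -/
theorem toVector_one : toVector K (1 : heckeAlgebra k G K) = single ((1 : G) : G ⧸ K) 1 :=
  rfl

/-- **Product rule**: `(S T) [K] = ∑_γ (T [K])(γ) • π(γ.out) (S [K])` — the product of
`End_G(k[G ⧸ K])` in terms of the vectors `S [K]`, `T [K]`. [folklore] -/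
theorem toVector_mul_eq_sum (S T : heckeAlgebra k G K) :
    toVector K (S * T) =
      ∑ γ ∈ (toVector K T).coeff.support, (toVector K T).coeff γ •
        ofMulAction k G (G ⧸ K) γ.out (toVector K S) := by
  rw [toVector_mul, apply_eq_extend_toVector]
  simp only [extend, LinearMap.coe_comp, LinearEquiv.coe_coe, Function.comp_apply,
    Finsupp.linearCombination_apply, Finsupp.sum, MonoidAlgebra.coeffLinearEquiv_apply]

/-- `[K] ∈ k[G ⧸ K]^K`. [folklore] -/
theorem single_one_mem_fixedPoints :
    single ((1 : G) : G ⧸ K) (1 : k) ∈ (ofMulAction k G (G ⧸ K)).fixedPoints K :=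
  toVector_mem_fixedPoints K 1

/-! ### The double-coset operators -/

section DoubleCoset

variable [IsHeckeTriple (⊤ : Submonoid G) K K]

/-- `𝟙_{KgK} = ∑_{α ∈ KgK/K} [α]` as a finite sum. [folklore] -/
theorem doubleCosetIndicator_eq_sum (g : G) :
    doubleCosetIndicator k G K g =
      ∑ α ∈ (finite_orbit_quotient K g).toFinset, single α (1 : k) := by
  rw [doubleCosetIndicator, finsum_mem_eq_finite_toFinset_sum _ (finite_orbit_quotient K g)]

/-- Coefficients of `𝟙_{KgK}`: `1` on the orbit `KgK/K`, `0` elsewhere. [folklore] -/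
theorem coeff_doubleCosetIndicator (g : G) (y : G ⧸ K) [Decidable (y ∈ orbit K (g : G ⧸ K))] :
    (doubleCosetIndicator k G K g).coeff y = if y ∈ orbit K (g : G ⧸ K) then 1 else 0 := by
  classical
  rw [doubleCosetIndicator_eq_sum, coeff_sum, Finset.sum_apply']
  simp only [coeff_single, Finsupp.single_apply]
  rw [Finset.sum_ite_eq' (finite_orbit_quotient K g).toFinset y (fun _ => (1 : k))]
  simp only [Set.Finite.mem_toFinset]

/-- `𝟙_{KgK}` is `K`-invariant. [folklore] -/
theorem ofMulAction_doubleCosetIndicator (g : G) {a : G} (ha : a ∈ K) :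
    ofMulAction k G (G ⧸ K) a (doubleCosetIndicator k G K g) = doubleCosetIndicator k G K g := by
  rw [← ofDoubleCosets_single, ofMulAction_ofDoubleCosets K _ a ha]

/-- The **double-coset operator** `T_{KgK}`: the element of `ℋ(G, K) = End_G(k[G ⧸ K])` sending
`[K]` to `𝟙_{KgK} = ∑_{yK ⊆ KgK} [yK]`, i.e. `[xK] ↦ ∑_{yK ⊆ KgK} [x y K]` — the basis element
of the double coset `KgK` (Shimura (1971), §3.1; Bump (1997), Prop. 4.1.2; Cartier, Corvallis
1979, §I.4). [cite: ShimuraIATAF1971, §3.1] -/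
def doubleCosetOperator (g : G) : heckeAlgebra k G K :=
  ofVector K (doubleCosetIndicator k G K g) fun _ ha => ofMulAction_doubleCosetIndicator K g ha

/-- `T_g [K] = 𝟙_{KgK}`. [folklore] -/
@[simp]
theorem toVector_doubleCosetOperator (g : G) :
    toVector K (doubleCosetOperator K g) = doubleCosetIndicator k G K g :=
  toVector_ofVector K _ _

/-- `T_g` is the inverse image of the delta function at `KgK` under the double-coset coordinates
`doubleCosetCoeffEquiv` of `HeckeAlgebra`. [folklore] -/
theorem doubleCosetOperator_eq_doubleCosetCoeffEquiv_symm (g : G) :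
    doubleCosetOperator (k := k) K g = (doubleCosetCoeffEquiv K).symm
      (Finsupp.single (HeckeCoset.mk K K ⟨g, Submonoid.mem_top g⟩) 1) := by
  rw [doubleCosetCoeffEquiv_symm_apply]
  refine Subtype.ext ?_
  change extend K (doubleCosetIndicator k G K g) = extend K _
  rw [ofDoubleCosets_single]

/-- `T_g` is the basis vector at `KgK` of the double-coset basis
`Module.Basis.ofRepr (doubleCosetCoeffEquiv K)` of `ℋ(G, K)` (the basis of
`exists_basis_heckeAlgebra_holds`). [folklore] -/
theorem ofRepr_doubleCosetCoeffEquiv_apply (g : G) :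
    Module.Basis.ofRepr (doubleCosetCoeffEquiv (k := k) K)
        (HeckeCoset.mk K K ⟨g, Submonoid.mem_top g⟩) = doubleCosetOperator K g := by
  rw [Module.Basis.coe_ofRepr, doubleCosetOperator_eq_doubleCosetCoeffEquiv_symm]

/-- **Right multiplication by `T_g` is the Hecke operator `[KgK]`** on `k[G ⧸ K]^K`:
`(S · T_g) [K] = [KgK] (S [K])` (`liftRep_doubleCosetIndicator`). [folklore] -/
theorem toVector_mul_doubleCosetOperator (S : heckeAlgebra k G K) (g : G) :
    toVector K (S * doubleCosetOperator K g) =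
      heckeOperator (ofMulAction k G (G ⧸ K)) K g (toVector K S) := by
  rw [toVector_mul, toVector_doubleCosetOperator, apply_eq_extend_toVector,
    extend_apply_eq_liftRep, liftRep_doubleCosetIndicator]

/-- `[KgK] [K] = 𝟙_{KgK}` in `k[G ⧸ K]`. [folklore] -/
theorem heckeOperator_single_one (g : G) :
    heckeOperator (ofMulAction k G (G ⧸ K)) K g (single ((1 : G) : G ⧸ K) 1) =
      doubleCosetIndicator k G K g := by
  rw [← toVector_one, ← toVector_mul_doubleCosetOperator, one_mul, toVector_doubleCosetOperator]

/-- The operator of the trivial double coset is `1`. [folklore] -/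
@[simp]
theorem doubleCosetOperator_one : doubleCosetOperator (k := k) K (1 : G) = 1 := by
  apply toVector_injective K
  rw [← one_mul (doubleCosetOperator K (1 : G)), toVector_mul_doubleCosetOperator, toVector_one,
    heckeOperator_one_apply _ K (single_one_mem_fixedPoints K)]

/-- The double-coset operator only depends on the orbit `KgK/K`. [folklore] -/
theorem doubleCosetOperator_eq_of_orbit_eq {g g' : G}
    (h : orbit K (g : G ⧸ K) = orbit K (g' : G ⧸ K)) :
    doubleCosetOperator (k := k) K g = doubleCosetOperator K g' := by
  apply toVector_injective K
  rw [toVector_doubleCosetOperator, toVector_doubleCosetOperator, doubleCosetIndicator,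
    doubleCosetIndicator, h]

/-- `T_{k₁ g k₂} = T_g` for `k₁, k₂ ∈ K`. [folklore] -/
theorem doubleCosetOperator_mul_mul_eq {g k₁ k₂ : G} (hk₁ : k₁ ∈ K) (hk₂ : k₂ ∈ K) :
    doubleCosetOperator (k := k) K (k₁ * g * k₂) = doubleCosetOperator K g :=
  doubleCosetOperator_eq_of_orbit_eq K (orbit_mk_mul_mul_eq K hk₁ hk₂)

/-- `T_{g'} = T_g` when `g'K ∈ K·gK`. [folklore] -/
theorem doubleCosetOperator_eq_of_mem_orbit {g g' : G} (h : (g' : G ⧸ K) ∈ orbit K (g : G ⧸ K)) :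
    doubleCosetOperator (k := k) K g' = doubleCosetOperator K g :=
  doubleCosetOperator_eq_of_orbit_eq K (MulAction.orbit_eq_iff.2 h)

/-- `(T_g T_h) [K] = [KhK] 𝟙_{KgK}`. [folklore] -/
theorem toVector_doubleCosetOperator_mul (g h : G) :
    toVector K (doubleCosetOperator K g * doubleCosetOperator K h) =
      heckeOperator (ofMulAction k G (G ⧸ K)) K h (doubleCosetIndicator k G K g) := by
  rw [toVector_mul_doubleCosetOperator, toVector_doubleCosetOperator]

/-- **Support of a product**: if `(T_g T_h) [K]` has a non-zero coefficient at `γ` then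
`γ = β̃ • α` with `β ∈ KhK/K`, `α ∈ KgK/K` (so `γ ⊆ KhK·KgK`) — the support of the structure
constants (Shimura (1971), Prop. 3.15). [folklore] -/
theorem exists_eq_out_smul_of_coeff_ne_zero {g h : G} {γ : G ⧸ K}
    (hγ : (toVector K (doubleCosetOperator (k := k) K g * doubleCosetOperator K h)).coeff γ ≠ 0) :
    ∃ β ∈ orbit K (h : G ⧸ K), ∃ α ∈ orbit K (g : G ⧸ K), γ = β.out • α := by
  classical
  rw [toVector_doubleCosetOperator_mul,
    heckeOperator_apply_eq_sum_out _ K h (finite_orbit_quotient K h)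
      ((Representation.mem_fixedPoints _ K _).2 fun _ ha =>
        ofMulAction_doubleCosetIndicator K g ha),
    coeff_sum, Finset.sum_apply'] at hγ
  obtain ⟨β, hβ, hβ0⟩ := Finset.exists_ne_zero_of_sum_ne_zero hγ
  rw [doubleCosetIndicator_eq_sum, map_sum, coeff_sum, Finset.sum_apply'] at hβ0
  obtain ⟨α, hα, hα0⟩ := Finset.exists_ne_zero_of_sum_ne_zero hβ0
  rw [Set.Finite.mem_toFinset] at hβ hα
  refine ⟨β, hβ, α, hα, ?_⟩
  rw [ofMulAction_single, coeff_single, Finsupp.single_apply] at hα0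
  by_contra hne
  exact hα0 (if_neg (Ne.symm hne))

/-- **The double-coset operators span the Hecke algebra**, with support control: `T` is a
`k`-combination of the `T_{γ.out}` over the cosets `γ` in the support of `T [K]` (the spanning
half of the double-coset basis `exists_basis_heckeAlgebra_holds`, refined by the support;
Shimura (1971), Prop. 3.1). [cite: ShimuraIATAF1971, Prop. 3.1] -/
theorem mem_span_doubleCosetOperator (T : heckeAlgebra k G K) :
    T ∈ Submodule.span k ((fun γ : G ⧸ K => doubleCosetOperator (k := k) K γ.out) ''
      ((toVector K T).coeff.support : Set (G ⧸ K))) := by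
  classical
  -- induction on the size of the support of `T [K]`
  suffices h : ∀ (m : ℕ) (T : heckeAlgebra k G K), (toVector K T).coeff.support.card ≤ m →
      T ∈ Submodule.span k ((fun γ : G ⧸ K => doubleCosetOperator (k := k) K γ.out) ''
        ((toVector K T).coeff.support : Set (G ⧸ K))) from h _ T le_rfl
  intro m
  induction m with
  | zero =>
    intro T hT
    have h0 : toVector K T = 0 := by
      rw [← coeff_eq_zero, ← Finsupp.support_eq_empty, ← Finset.card_eq_zero]
      exact Nat.le_zero.1 hT
    have hT0 : T = 0 := toVector_injective K (by rw [h0, map_zero])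
    rw [hT0]
    exact Submodule.zero_mem _
  | succ m ih =>
    intro T hT
    by_cases hempty : (toVector K T).coeff.support = ∅
    · have h0 : toVector K T = 0 := by rw [← coeff_eq_zero, ← Finsupp.support_eq_empty, hempty]
      have hT0 : T = 0 := toVector_injective K (by rw [h0, map_zero])
      rw [hT0]
      exact Submodule.zero_mem _
    obtain ⟨γ, hγ⟩ := Finset.nonempty_iff_ne_empty.2 hempty
    -- `w = T [K]`, `c = w(γ)`, `T' = T - c • T_γ` (introduced as opaque names)
    obtain ⟨w, hw⟩ : ∃ w, w = toVector K T := ⟨_, rfl⟩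
    obtain ⟨c, hc⟩ : ∃ c, c = w.coeff γ := ⟨_, rfl⟩
    obtain ⟨T', hT'⟩ : ∃ T' : heckeAlgebra k G K, T' = T - c • doubleCosetOperator K γ.out :=
      ⟨_, rfl⟩
    rw [← hw] at hT hγ ⊢
    have hwK : ∀ a ∈ K, ofMulAction k G (G ⧸ K) a w = w := fun a ha =>
      hw ▸ ofMulAction_toVector K T ha
    -- (on the subalgebra, `-` is `AddSubgroupClass.sub`: use `map_sub` in term mode, not `rw`)
    have hvT' : toVector K T' = w - c • doubleCosetIndicator k G K γ.out := by
      rw [hT', hw]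
      exact (map_sub (toVector K) _ _).trans (by rw [map_smul, toVector_doubleCosetOperator])
    -- the new vector vanishes on the orbit of `γ` and agrees with `w` elsewhere
    have hcoeff : ∀ y, (toVector K T').coeff y = if y ∈ orbit K γ then 0 else w.coeff y := by
      intro y
      rw [hvT', coeff_sub, coeff_smul, Finsupp.sub_apply, Finsupp.smul_apply,
        coeff_doubleCosetIndicator, QuotientGroup.out_eq']
      split_ifs with hy
      · rw [smul_eq_mul, mul_one, coeff_eq_of_mem_orbit K hwK hy, ← hc, sub_self]
      · rw [smul_zero, sub_zero]
    have hsupp : (toVector K T').coeff.support ⊆ w.coeff.support.erase γ := by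
      intro y hy
      rw [Finsupp.mem_support_iff, hcoeff] at hy
      rw [Finset.mem_erase, Finsupp.mem_support_iff]
      split_ifs at hy with hy'
      · exact absurd rfl hy
      · exact ⟨fun h => hy' (by rw [h]; exact mem_orbit_self γ), hy⟩
    have hcard : (toVector K T').coeff.support.card ≤ m := by
      have := Finset.card_le_card hsupp
      rw [Finset.card_erase_of_mem hγ] at this
      omega
    have hsub : Submodule.span k ((fun γ : G ⧸ K => doubleCosetOperator (k := k) K γ.out) ''
        ((toVector K T').coeff.support : Set (G ⧸ K))) ≤
        Submodule.span k ((fun γ : G ⧸ K => doubleCosetOperator (k := k) K γ.out) ''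
          (w.coeff.support : Set (G ⧸ K))) :=
      Submodule.span_mono (Set.image_mono fun y hy => Finset.mem_of_mem_erase (hsupp hy))
    have hγmem : doubleCosetOperator (k := k) K γ.out ∈ Submodule.span k
        ((fun γ : G ⧸ K => doubleCosetOperator (k := k) K γ.out) ''
          (w.coeff.support : Set (G ⧸ K))) :=
      Submodule.subset_span ⟨γ, hγ, rfl⟩
    have hTT' : T = T' + c • doubleCosetOperator K γ.out := by
      rw [hT']
      exact (sub_add_cancel T _).symm
    rw [hTT']
    exact Submodule.add_mem _ (hsub (ih T' hcard)) (Submodule.smul_mem _ _ hγmem)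

/-- Every element of the Hecke algebra is in the `k`-span of all double-coset operators.
[folklore] -/
theorem mem_span_range_doubleCosetOperator (T : heckeAlgebra k G K) :
    T ∈ Submodule.span k (Set.range (doubleCosetOperator (k := k) K)) :=
  Submodule.span_mono (by rintro _ ⟨γ, -, rfl⟩; exact ⟨γ.out, rfl⟩)
    (mem_span_doubleCosetOperator K T)

/-! ### Central twists -/

omit [IsHeckeTriple (⊤ : Submonoid G) K K] in
/-- The `K`-orbit of `(z g) K` for central `z` is `z •` the orbit of `g K`. [folklore] -/
theorem orbit_mk_central_mul {z : G} (hz : ∀ x : G, x * z = z * x) (g : G) :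
    orbit K ((z * g : G) : G ⧸ K) = (z • ·) '' orbit K (g : G ⧸ K) := by
  ext γ
  simp only [mem_orbit_mk_iff, Set.mem_image]
  constructor
  · rintro ⟨κ, rfl⟩
    refine ⟨((κ : G) * g : G), ⟨κ, rfl⟩, ?_⟩
    rw [MulAction.Quotient.smul_mk, smul_eq_mul, ← mul_assoc, ← mul_assoc, hz κ]
  · rintro ⟨_, ⟨κ, rfl⟩, rfl⟩
    refine ⟨κ, ?_⟩
    rw [MulAction.Quotient.smul_mk, smul_eq_mul, ← mul_assoc, ← mul_assoc, hz κ]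

/-- `𝟙_{K z g K} = π(z) 𝟙_{K g K}` for central `z`. [folklore] -/
theorem doubleCosetIndicator_central_mul {z : G} (hz : ∀ x : G, x * z = z * x) (g : G) :
    doubleCosetIndicator k G K (z * g) =
      ofMulAction k G (G ⧸ K) z (doubleCosetIndicator k G K g) := by
  classical
  rw [doubleCosetIndicator_eq_sum, doubleCosetIndicator_eq_sum, map_sum]
  simp only [ofMulAction_single]
  have himg : (finite_orbit_quotient K (z * g)).toFinset =
      (finite_orbit_quotient K g).toFinset.image (z • ·) := by
    ext γ
    rw [Set.Finite.mem_toFinset, Finset.mem_image, orbit_mk_central_mul K hz g, Set.mem_image]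
    simp only [Set.Finite.mem_toFinset]
  rw [himg, Finset.sum_image fun x _ y _ h => smul_left_cancel z h]

/-- **Central twist** (Shimura (1971), Prop. 3.17, `T(c, …, c) T(b) = T(cb)`): for `z` central in
`G`, `T_z T_g = T_{z g}` in `ℋ(G, K)`.  Indeed `K z K = z K` is a single coset, so
`(T_z T_g) [K] = [KgK] [zK] = ∑_{yK ⊆ KgK} [y z K] = z • 𝟙_{KgK} = 𝟙_{K zg K}`.
[cite: ShimuraIATAF1971, Prop. 3.17] -/
theorem doubleCosetOperator_central_mul {z : G} (hz : ∀ x : G, x * z = z * x) (g : G) :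
    doubleCosetOperator (k := k) K z * doubleCosetOperator K g = doubleCosetOperator K (z * g) := by
  classical
  apply toVector_injective K
  rw [toVector_mul_doubleCosetOperator, toVector_doubleCosetOperator, toVector_doubleCosetOperator,
    doubleCosetIndicator_central_mul K hz,
    heckeOperator_apply_eq_sum_out _ K g (finite_orbit_quotient K g)
      ((Representation.mem_fixedPoints _ K _).2 fun _ ha => ofMulAction_doubleCosetIndicator K z ha),
    doubleCosetIndicator_eq_sum K g, map_sum]
  refine Finset.sum_congr rfl fun α _ => ?_
  -- `K z K / K = {zK}`, so `𝟙_{KzK} = [zK]` and `α.out • [zK] = [α.out z K] = z • [α]`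
  have horb : (finite_orbit_quotient K z).toFinset = {((z : G) : G ⧸ K)} := by
    ext y
    rw [Set.Finite.mem_toFinset, Finset.mem_singleton, mem_orbit_mk_iff]
    constructor
    · rintro ⟨κ, rfl⟩
      rw [hz κ, QuotientGroup.eq, _root_.mul_inv_rev, inv_mul_cancel_right]
      exact K.inv_mem κ.2
    · rintro rfl
      exact ⟨1, by rw [OneMemClass.coe_one, one_mul]⟩
  rw [doubleCosetIndicator_eq_sum K z, horb, Finset.sum_singleton, ofMulAction_single,
    ofMulAction_single, MulAction.Quotient.smul_mk, smul_eq_mul, hz]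
  conv_rhs => rw [← QuotientGroup.out_eq' α, MulAction.Quotient.smul_mk, smul_eq_mul]

end DoubleCoset

end heckeAlgebra

end Literature.NumberTheory.Automorphic
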